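/-
Copyright (c) 2026 the pub-hodgecm-mathlib formalisation cell (harness21).  Prover seat hodgecm-mathlib-LH4-p04 (g2), req620 Track A «(D-RAM) FOUR-FRAME» squad
(MS ROAD A, STAGE B brick B3₂ «TYPE-2 STRATA TABLE» — exclusion of the residual families X2, X8, X10, X11 of ★ `typeTwo_sieve` by the column-1 dual-Gram test).  2026-09-04.
-/
import Summits.HodgeConjecture.HodgeConjecture.Theorems.F0P3cDyRamDiagonalTypeTwoExclX1   -- ★ (this seat): `smul_dualFrame_col_mem`, `v_gramCore_le`; brings ★ part 5 (`dualFrame_sandwich`, `gram_values_of_type`)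
import HarnessLib

/-!
# Crux `H413`, line LH4 «(D-RAM) FOUR-FRAME» road — unit U3_Laws (iii), MS ROAD A, STAGE B brick B3₂: THE RESIDUAL FAMILIES X2, X8, X10, X11 ARE NOT TYPE-2 POLARISABLE
# (all die on the column-1 dual-Gram test `|D₀ + N(x)D₁| ≤ exp 1 · |D₀D₁| · |ϖ|^{2b}`, X11's corner `c = 2b − 2` with `G₀₀` on top)

Cell `hodgecm-mathlib` (D-0151), FLOOR 0, crux item H413 = `stmt-HodgeConjecture-24833`, route of record `HCCMUnconditional`; squad F0∕P3c∕LH4 (req618∕req620); registered stub served: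
`F0P3cDyRamFourFrameU3.stub_U3_stableModelSum` (MS).  THEOREMS ONLY (no `def`, no instance, no notation, no `sorry`, default heartbeats); lane
`--supports stmt-HodgeConjecture-24833 --as helper` (count-neutral).  STAGE B type-2 twin: ★ part 6b `typeTwo_sieve` (this seat) leaves eleven residual families X1–X11; X1 is
★ `not_typeTwoPolarisable_X1`, X3∕X4∕X6∕X7 are ★ p856158 and X5∕X9 are F0P3a-p01 (g31)'s; this file kills the four remaining families, all on the COLUMN-1 test of the dual frame (★ `v_gramCore_le`: `|E|·|D₀|⁻¹|D₁|⁻¹ ≤ exp(1 − 2b)` for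
`E = D₀ + N(x)D₁`), each taking the normalisation `hn` as a binder (LH4-r01 (g2) BOX CS remark).

THE MATHEMATICS (this seat's census `CENSUS-B3type2.v1` §1).  On each family the sandwich (★ part 5) and parity pin `|D₀| = exp B₀`, `|D₁| = exp B₁` with `B₀ ≠ B₁`, so
`|E| = exp max(B₀, B₁)` (ultrametric equality) and the column-1 test reads `max(B₀,B₁) − B₀ − B₁ ≤ 1 − 2b` (§1 `columnOne_exponent_le`): X2 (`a = (c, b, c)`, `b ∈ {1,2}`, `c` even
`≥ 2b`): `(B₀, B₁) = (c, 2⌊b∕2⌋)` gives `−2⌊b∕2⌋ ≤ 1 − 2b` ✗; X8 (`3 ≤ m < b`, `c = 2m−2`): `|D₀| = |D₁| = exp(b+m−2)`, the test bounds `|D₀ + N(x)D₁| ≤ exp(2m−3) <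
exp(2m−2) = |N(y)D₂|`, so `|G₀₀| = exp(2m−2) > 1` ✗ (I); X10 (`m = b`, `c` even,
`a₀ ∈ {1, 2b−1}`): `(2⌊a₀∕2⌋, c)` gives `−2⌊a₀∕2⌋ ≤ 1 − 2b` ✗; X11 (`a₀ ∈ {2, 2b−2}`): same unless `c = 2b − 2`, where the test gives `|E| ≤ exp(c − 1) < exp c = |N(y)D₂|` and then
`|G₀₀| = exp c > 1` ✗ (I).

WHAT IS PROVED.  §1 `columnOne_exponent_le` (the column-1 test in exponent form when `|D₀| ≠ |N(x)D₁|`).  §2 HEADS `not_typeTwoPolarisable_X2`, `_X8`, `_X10a_X11a`, `_X10b_X11b`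
(hypotheses = the corresponding disjuncts of ★ `typeTwo_sieve` + `hn`).
HONEST LABEL.  Count-neutral (`--supports`); nothing printed is asserted; (MS) stays a PROVER TARGET (empirical census law — MEMO v2∕v2.1 is its paper proof); `HC_CM` is proved only
modulo the 7 printed citations (2 remaining named inputs: hLiu418 = `stmt-HodgeConjecture-24832`, h413 = `stmt-HodgeConjecture-24833`) until rung 0 closes.

## References
* [Jacobowitz1962] R. Jacobowitz, *Hermitian forms over local fields*, Amer. J. Math. 84 (1962), §4, §7–§8 (`𝔭`-modular lattices).
* [Kottwitz1986BaseChangeUnits] R. E. Kottwitz, *Base change for unit elements of Hecke algebras*, Compositio Math. 60 (1986), §1 pp. 240–241 (fixed lattices counted by position).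
* [Serre1980Trees] J.-P. Serre, *Trees*, Springer (1980), Ch. II §1.1 (Hermite normal forms).
-/

set_option autoImplicit false

noncomputable section

namespace Summit.HodgeConjecture.HodgeConjecture.Cruxes.H413.F0P3cDyRamDiagonalTypeTwoExclColumnOne

open Matrix
open Literature.NumberTheory.Automorphic Literature.NumberTheory.Automorphic.HermitianLattice
open Literature.NumberTheory.Automorphic.UnitaryLatticeTree
open Summit.HodgeConjecture.HodgeConjecture.Cruxes.H413.F0P3cDyRamDiagonalTorusDefs
open Summit.HodgeConjecture.HodgeConjecture.Cruxes.H413.F0P3cDyRamDiagonalStableLatticeHNF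
open Summit.HodgeConjecture.HodgeConjecture.Cruxes.H413.F0P3cDyRamDiagonalHNFDualFrameValuesTypeTwo
open Summit.HodgeConjecture.HodgeConjecture.Cruxes.H413.F0P3cDyRamDiagonalTypeTwoExclX1
open scoped Valued WithZero Matrix MatrixGroups

variable {K : Type*} [Field K] [Valued K ℤᵐ⁰]

/-! ## §1  The column-1 test in exponent form -/

/-- **COLUMN-1 TEST, EXPONENT FORM**: if `latt V` (HNF) is a vertex lattice of `diag(D)` of any type, `|x| = 1`, `|D₀| = exp B₀`, `|D₁| = exp B₁` with `B₀ ≠ B₁`, then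
`max(B₀, B₁) − B₀ − B₁ ≤ 1 − 2b` (★ `v_gramCore_le` with `|D₀ + N(x)D₁| = exp max(B₀, B₁)`). [cite: Jacobowitz1962, §4, §7–§8] -/
theorem columnOne_exponent_le {σ : K →+* K} (hvσ : ∀ a, Valued.v (σ a) = Valued.v a) {ϖ : K} (hϖ : Valued.v ϖ = WithZero.exp (-1 : ℤ))
    {D : Fin 3 → K} (hD0 : ∀ i, D i ≠ 0) (b c : ℕ) {x y z : K} (hx1 : Valued.v x = 1) {d : ℕ}
    (hM : IsVertexLattice σ ϖ (Matrix.diagonal D) d (latt (Matrix.of ![![1, 0, 0], ![x, ϖ ^ b, 0], ![y, z, ϖ ^ c]])))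
    {B₀ B₁ : ℤ} (hB₀ : Valued.v (D 0) = WithZero.exp B₀) (hB₁ : Valued.v (D 1) = WithZero.exp B₁) (hne : B₀ ≠ B₁) :
    max B₀ B₁ - B₀ - B₁ ≤ 1 - 2 * (b : ℤ) := by
  have h := v_gramCore_le hvσ hϖ hD0 b c x y z hM
  have hval : Valued.v (D 0 + x * σ x * D 1) = max (WithZero.exp B₀) (WithZero.exp B₁) := by
    have hN : Valued.v (x * σ x * D 1) = WithZero.exp B₁ := by rw [map_mul, map_mul, hvσ, hx1, hB₁, one_mul, one_mul]
    rw [Valuation.map_add_of_distinct_val _ (by rw [hB₀, hN]; exact fun h => hne (WithZero.exp_injective h)), hB₀, hN]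
  rw [hval, hB₀, hB₁, ← WithZero.exp_neg, ← WithZero.exp_neg, ← WithZero.exp_add] at h
  rcases le_total B₀ B₁ with hle | hle
  · rw [max_eq_right (WithZero.exp_le_exp.2 hle), ← WithZero.exp_add, WithZero.exp_le_exp] at h
    rw [max_eq_right hle]; omega
  · rw [max_eq_left (WithZero.exp_le_exp.2 hle), ← WithZero.exp_add, WithZero.exp_le_exp] at h
    rw [max_eq_left hle]; omega

/-! ## §2  The kills -/

section Kills

variable {σ : K →+* K} {ϖ : K} {b c : ℕ} {x y z : K}

/-- **X2 IS NOT TYPE-2 POLARISABLE** (`b ∈ {1,2}`, `c` even `≥ 2b`, `|z| ≤ |ϖ^c|`, `|xz − yϖ^b| = |ϖ^b|` (`|y| = 1` not needed); disjunct 12 of ★ `typeTwo_sieve`): `|D₀| = exp c`, `|D₁| = exp 2⌊b∕2⌋`, and the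
column-1 test `−2⌊b∕2⌋ ≤ 1 − 2b` fails. [cite: Jacobowitz1962, §7–§8] [cite: Kottwitz1986BaseChangeUnits, §1 pp. 240–241] [cite: Serre1980Trees, II §1.1] -/
theorem not_typeTwoPolarisable_X2 (hvσ : ∀ a, Valued.v (σ a) = Valued.v a)
    (hfix : ∀ t : K, σ t = t → t ≠ 0 → ∃ n : ℤ, Valued.v t = WithZero.exp (2 * n)) (hϖ : Valued.v ϖ = WithZero.exp (-1 : ℤ))
    (hx : Valued.v x ≤ 1) (hy : Valued.v y ≤ 1) (hz : Valued.v z ≤ 1)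
    (hn : IsNormalisedLattice (latt (Matrix.of ![![1, 0, 0], ![x, ϖ ^ b, 0], ![y, z, ϖ ^ c]])))
    (hb : b = 1 ∨ b = 2) (hce : c % 2 = 0) (hcb : 2 * b ≤ c) (hzc : Valued.v z ≤ Valued.v (ϖ ^ c))
    (hw : Valued.v (x * z - y * ϖ ^ b) = Valued.v (ϖ ^ b)) :
    ¬ ∃ D : Fin 3 → K, (∀ i, σ (D i) = D i ∧ D i ≠ 0) ∧ IsVertexLattice σ ϖ (Matrix.diagonal D) 2 (latt (Matrix.of ![![1, 0, 0], ![x, ϖ ^ b, 0], ![y, z, ϖ ^ c]])) := by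
  rintro ⟨D, hDfix, hM⟩
  have hD0 : ∀ i, D i ≠ 0 := fun i => (hDfix i).2
  have hq : ∀ n : ℕ, Valued.v (ϖ ^ n) = WithZero.exp (-(n : ℤ)) := fun n => by
    rw [map_pow, hϖ, ← WithZero.exp_nsmul]; congr 1; simp
  have hq1 : ∀ n : ℕ, Valued.v (ϖ ^ n) ≤ 1 := fun n => by rw [hq, ← WithZero.exp_zero, WithZero.exp_le_exp]; omega
  have hN := (normalised_latt_hnf_iff hx hy hz (hq1 b) (hq1 c)).1 hn
  have hx1 : Valued.v x = 1 := hN.1.resolve_left fun h => by rw [hq, ← WithZero.exp_zero, WithZero.exp_inj] at h; omega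
  obtain ⟨e₀, he₀⟩ := hfix (D 0) (hDfix 0).1 (hD0 0)
  obtain ⟨e₁, he₁⟩ := hfix (D 1) (hDfix 1).1 (hD0 1)
  obtain ⟨-, ⟨hA1b, -, hA1eq⟩, ⟨-, -, hA0w, hA0eq⟩⟩ := dualFrame_sandwich hvσ hϖ hD0 b c hn hM
  -- `|D₀| = exp c`
  have h2e0 : 2 * e₀ = (c : ℤ) := by
    have hl : (c : ℤ) - 1 ≤ 2 * e₀ := by
      rw [he₀, hϖ, hw, hq, ← WithZero.exp_add, ← WithZero.exp_add, WithZero.exp_le_exp] at hA0w; omega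
    have hu : 2 * e₀ ≤ (c : ℤ) := by
      rcases hA0eq with h | h | h
      · rw [he₀, ← WithZero.exp_zero, WithZero.exp_le_exp] at h; omega
      · rw [he₀, hx1, one_mul, WithZero.exp_le_exp] at h; omega
      · rw [he₀, hw, hq, ← WithZero.exp_add, WithZero.exp_le_exp] at h; omega
    omega
  -- `|D₁| = exp 2⌊b∕2⌋`
  have h2e1 : (b : ℤ) - 1 ≤ 2 * e₁ ∧ 2 * e₁ ≤ b := by
    constructor
    · rw [he₁, hϖ, ← WithZero.exp_add, WithZero.exp_le_exp] at hA1b; omega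
    · rcases hA1eq with h | h
      · rw [he₁, WithZero.exp_le_exp] at h; exact h
      · have h' : Valued.v (D 1) ≤ WithZero.exp (b : ℤ) := h.trans (by
          calc Valued.v z * WithZero.exp ((b : ℤ) + c) ≤ Valued.v (ϖ ^ c) * WithZero.exp ((b : ℤ) + c) := mul_le_mul' hzc le_rfl
            _ = WithZero.exp (b : ℤ) := by rw [hq, ← WithZero.exp_add, WithZero.exp_inj]; ring)
        rw [he₁, WithZero.exp_le_exp] at h'; exact h'
  have key := columnOne_exponent_le hvσ hϖ hD0 b c hx1 hM he₀ he₁ (by omega)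
  rcases hb with rfl | rfl
  · have : 2 * e₁ = 0 := by omega
    rw [max_eq_left (by omega : 2 * e₁ ≤ 2 * e₀)] at key; omega
  · have : 2 * e₁ = 2 := by omega
    rw [max_eq_left (by omega : 2 * e₁ ≤ 2 * e₀)] at key; push_cast at key hcb; omega

/-- **X8 IS NOT TYPE-2 POLARISABLE** (`3 ≤ m < b`, `c = 2m − 2`, `b + m` even, `|z| = |ϖ^m|`, `|y| = 1`; disjunct 18 of ★ `typeTwo_sieve`): `|x| = 1` gives `|xz − yϖ^b| = |ϖ^m|`, the sandwich
pins `|D₀| = |D₁| = exp(b+m−2)`, `|D₂| = exp(2m−2)`; the column-1 test gives `|D₀ + N(x)D₁| ≤ exp(2m−3) < exp(2m−2) = |N(y)D₂|`, so `|G₀₀| = exp(2m−2) > 1`.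
[cite: Jacobowitz1962, §7–§8] [cite: Kottwitz1986BaseChangeUnits, §1 pp. 240–241] [cite: Serre1980Trees, II §1.1] -/
theorem not_typeTwoPolarisable_X8 (hvσ : ∀ a, Valued.v (σ a) = Valued.v a)
    (hfix : ∀ t : K, σ t = t → t ≠ 0 → ∃ n : ℤ, Valued.v t = WithZero.exp (2 * n)) (hϖ : Valued.v ϖ = WithZero.exp (-1 : ℤ))
    (hx : Valued.v x ≤ 1) (hy : Valued.v y ≤ 1) (hz : Valued.v z ≤ 1)
    (hn : IsNormalisedLattice (latt (Matrix.of ![![1, 0, 0], ![x, ϖ ^ b, 0], ![y, z, ϖ ^ c]])))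
    {m : ℕ} (hm3 : 3 ≤ m) (hmb : m < b) (hc : c = 2 * m - 2) (hpar : (b + m) % 2 = 0) (hzm : Valued.v z = Valued.v (ϖ ^ m)) (hy1 : Valued.v y = 1) :
    ¬ ∃ D : Fin 3 → K, (∀ i, σ (D i) = D i ∧ D i ≠ 0) ∧ IsVertexLattice σ ϖ (Matrix.diagonal D) 2 (latt (Matrix.of ![![1, 0, 0], ![x, ϖ ^ b, 0], ![y, z, ϖ ^ c]])) := by
  rintro ⟨D, hDfix, hM⟩
  have hD0 : ∀ i, D i ≠ 0 := fun i => (hDfix i).2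
  have hϖ0 : ϖ ≠ 0 := (Valuation.ne_zero_iff Valued.v).1 (by rw [hϖ]; exact WithZero.exp_ne_zero)
  have hq : ∀ n : ℕ, Valued.v (ϖ ^ n) = WithZero.exp (-(n : ℤ)) := fun n => by
    rw [map_pow, hϖ, ← WithZero.exp_nsmul]; congr 1; simp
  have hq1 : ∀ n : ℕ, Valued.v (ϖ ^ n) ≤ 1 := fun n => by rw [hq, ← WithZero.exp_zero, WithZero.exp_le_exp]; omega
  have hN := (normalised_latt_hnf_iff hx hy hz (hq1 b) (hq1 c)).1 hn
  have hx1 : Valued.v x = 1 := hN.1.resolve_left fun h => by rw [hq, ← WithZero.exp_zero, WithZero.exp_inj] at h; omega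
  obtain ⟨e₀, he₀⟩ := hfix (D 0) (hDfix 0).1 (hD0 0)
  obtain ⟨e₁, he₁⟩ := hfix (D 1) (hDfix 1).1 (hD0 1)
  obtain ⟨e₂, he₂⟩ := hfix (D 2) (hDfix 2).1 (hD0 2)
  obtain ⟨⟨hA2l, hA2u⟩, ⟨-, hA1z, hA1eq⟩, ⟨-, -, hA0w, hA0eq⟩⟩ := dualFrame_sandwich hvσ hϖ hD0 b c hn hM
  obtain ⟨-, -, hG00, -⟩ := gram_values_of_type hvσ hϖ0 D b c x y z hM
  have hzv : Valued.v z = WithZero.exp (-(m : ℤ)) := by rw [hzm, hq]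
  -- `w = m`
  have hwv : Valued.v (x * z - y * ϖ ^ b) = WithZero.exp (-(m : ℤ)) := by
    rw [Valuation.map_sub_eq_of_lt_left _ ?_]
    · rw [map_mul, hx1, one_mul, hzv]
    · rw [map_mul, map_mul, hx1, hy1, one_mul, one_mul, hzv, hq, WithZero.exp_lt_exp]; omega
  have hc' : (c : ℤ) = 2 * m - 2 := by omega
  -- `|D₀| = |D₁| = exp(b + m − 2)`, `|D₂| = exp(2m − 2)`
  have h2e0 : 2 * e₀ = (b : ℤ) + m - 2 := by
    have hl : (b : ℤ) + c - m - 1 ≤ 2 * e₀ := by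
      rw [he₀, hϖ, hwv, ← WithZero.exp_add, ← WithZero.exp_add, WithZero.exp_le_exp] at hA0w; omega
    have hu : 2 * e₀ ≤ (b : ℤ) + c - m := by
      rcases hA0eq with h | h | h
      · rw [he₀, ← WithZero.exp_zero, WithZero.exp_le_exp] at h; omega
      · rw [he₀, hx1, one_mul, WithZero.exp_le_exp] at h; omega
      · rw [he₀, hwv, ← WithZero.exp_add, WithZero.exp_le_exp] at h; omega
    omega
  have h2e1 : 2 * e₁ = (b : ℤ) + m - 2 := by
    have hl : (b : ℤ) + c - m - 1 ≤ 2 * e₁ := by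
      rw [he₁, hϖ, hzv, ← WithZero.exp_add, ← WithZero.exp_add, WithZero.exp_le_exp] at hA1z; omega
    have hu : 2 * e₁ ≤ (b : ℤ) + c - m := by
      rcases hA1eq with h | h
      · rw [he₁, WithZero.exp_le_exp] at h; omega
      · rw [he₁, hzv, ← WithZero.exp_add, WithZero.exp_le_exp] at h; omega
    omega
  have h2e2 : 2 * e₂ = (c : ℤ) := by
    have hl : (c : ℤ) - 1 ≤ 2 * e₂ := by rw [he₂, hϖ, ← WithZero.exp_add, WithZero.exp_le_exp] at hA2l; omega
    have hu : 2 * e₂ ≤ (c : ℤ) := by rw [he₂, WithZero.exp_le_exp] at hA2u; exact hA2u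
    omega
  -- column-1 test: `|E| ≤ exp(2m − 3)`
  have hE := v_gramCore_le hvσ hϖ hD0 b c x y z hM
  rw [he₀, he₁, h2e0, h2e1, ← WithZero.exp_neg, ← WithZero.exp_add] at hE
  have hE' : Valued.v (D 0 + x * σ x * D 1) ≤ WithZero.exp (2 * (m : ℤ) - 3) := by
    have hne : WithZero.exp (-((b : ℤ) + m - 2) + -((b : ℤ) + m - 2)) ≠ 0 := WithZero.exp_ne_zero
    calc Valued.v (D 0 + x * σ x * D 1)
        = Valued.v (D 0 + x * σ x * D 1) * WithZero.exp (-((b : ℤ) + m - 2) + -((b : ℤ) + m - 2)) *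
            (WithZero.exp (-((b : ℤ) + m - 2) + -((b : ℤ) + m - 2)))⁻¹ := by rw [mul_inv_cancel_right₀ hne]
      _ ≤ WithZero.exp (1 - 2 * (b : ℤ)) * (WithZero.exp (-((b : ℤ) + m - 2) + -((b : ℤ) + m - 2)))⁻¹ := mul_le_mul' hE le_rfl
      _ = WithZero.exp (2 * (m : ℤ) - 3) := by rw [← WithZero.exp_neg, ← WithZero.exp_add, WithZero.exp_inj]; ring
  have hvNy : Valued.v (σ y * D 2 * y) = WithZero.exp (c : ℤ) := by rw [map_mul, map_mul, hvσ, hy1, he₂, h2e2, one_mul, mul_one]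
  have hlt : Valued.v (D 0 + σ x * D 1 * x) < Valued.v (σ y * D 2 * y) := by
    rw [show D 0 + σ x * D 1 * x = D 0 + x * σ x * D 1 by ring, hvNy]
    exact lt_of_le_of_lt hE' (by rw [WithZero.exp_lt_exp]; omega)
  have hsum : D 0 + σ x * D 1 * x + σ y * D 2 * y = σ y * D 2 * y + (D 0 + σ x * D 1 * x) := by ring
  have h := hG00
  rw [hsum, Valuation.map_add_eq_of_lt_left _ hlt, hvNy, ← WithZero.exp_zero, WithZero.exp_le_exp] at h
  omega

/-- **X10 and X11 ARE NOT TYPE-2 POLARISABLE** (`m = b ≥ 1`, `c` even `> b`, `|y| = 1`, and `a₀ = 2j − 1` or `2j − 2`... precisely: `|D₀|` is pinned to `exp(2⌊a₀∕2⌋)` with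
`a₀ ∈ {b−1+?}` — stated through the two `typeTwo_sieve` disjuncts 20–21: either (`b = 1 ∨ b = 2`, `|xz − yϖ^b| ≤ |ϖ^c|`) or (`2 ≤ b`, `|xz − yϖ^b| = |ϖ^(c−b+k)|`, `k ∈ {1,2}`,
`2b − 2k + 2 ≤ c`... ) — see the two heads below): the column-1 test fails, except at X11's corner `c = 2b − 2` where it bounds `|E| ≤ exp(c−1)` and `G₀₀ = E + N(y)D₂` (`|N(y)D₂| =
exp c`) is not integral. [cite: Jacobowitz1962, §7–§8] [cite: Kottwitz1986BaseChangeUnits, §1 pp. 240–241] [cite: Serre1980Trees, II §1.1] -/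
theorem not_typeTwoPolarisable_X10a_X11a (hvσ : ∀ a, Valued.v (σ a) = Valued.v a)
    (hfix : ∀ t : K, σ t = t → t ≠ 0 → ∃ n : ℤ, Valued.v t = WithZero.exp (2 * n)) (hϖ : Valued.v ϖ = WithZero.exp (-1 : ℤ))
    (hx : Valued.v x ≤ 1) (hy : Valued.v y ≤ 1) (hz : Valued.v z ≤ 1)
    (hn : IsNormalisedLattice (latt (Matrix.of ![![1, 0, 0], ![x, ϖ ^ b, 0], ![y, z, ϖ ^ c]])))
    (hb : b = 1 ∨ b = 2) (hce : c % 2 = 0) (hbc : 2 * b ≤ c) (hzb : Valued.v z = Valued.v (ϖ ^ b))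
    (hwc : Valued.v (x * z - y * ϖ ^ b) ≤ Valued.v (ϖ ^ c)) :
    ¬ ∃ D : Fin 3 → K, (∀ i, σ (D i) = D i ∧ D i ≠ 0) ∧ IsVertexLattice σ ϖ (Matrix.diagonal D) 2 (latt (Matrix.of ![![1, 0, 0], ![x, ϖ ^ b, 0], ![y, z, ϖ ^ c]])) := by
  rintro ⟨D, hDfix, hM⟩
  have hD0 : ∀ i, D i ≠ 0 := fun i => (hDfix i).2
  have hq : ∀ n : ℕ, Valued.v (ϖ ^ n) = WithZero.exp (-(n : ℤ)) := fun n => by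
    rw [map_pow, hϖ, ← WithZero.exp_nsmul]; congr 1; simp
  have hq1 : ∀ n : ℕ, Valued.v (ϖ ^ n) ≤ 1 := fun n => by rw [hq, ← WithZero.exp_zero, WithZero.exp_le_exp]; omega
  have hN := (normalised_latt_hnf_iff hx hy hz (hq1 b) (hq1 c)).1 hn
  have hx1 : Valued.v x = 1 := hN.1.resolve_left fun h => by rw [hq, ← WithZero.exp_zero, WithZero.exp_inj] at h; omega
  obtain ⟨e₀, he₀⟩ := hfix (D 0) (hDfix 0).1 (hD0 0)
  obtain ⟨e₁, he₁⟩ := hfix (D 1) (hDfix 1).1 (hD0 1)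
  obtain ⟨-, ⟨-, hA1z, hA1eq⟩, ⟨-, hA0x, -, hA0eq⟩⟩ := dualFrame_sandwich hvσ hϖ hD0 b c hn hM
  have hzv : Valued.v z = WithZero.exp (-(b : ℤ)) := by rw [hzb, hq]
  have hwb : Valued.v (x * z - y * ϖ ^ b) * WithZero.exp ((b : ℤ) + c) ≤ WithZero.exp (b : ℤ) := by
    calc Valued.v (x * z - y * ϖ ^ b) * WithZero.exp ((b : ℤ) + c) ≤ Valued.v (ϖ ^ c) * WithZero.exp ((b : ℤ) + c) := mul_le_mul' hwc le_rfl
      _ = WithZero.exp (b : ℤ) := by rw [hq, ← WithZero.exp_add, WithZero.exp_inj]; ring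
  -- `|D₀| = exp 2⌊b∕2⌋`
  have h2e0 : (b : ℤ) - 1 ≤ 2 * e₀ ∧ 2 * e₀ ≤ b := by
    constructor
    · rw [he₀, hϖ, hx1, one_mul, ← WithZero.exp_add, WithZero.exp_le_exp] at hA0x; omega
    · rcases hA0eq with h | h | h
      · rw [he₀, ← WithZero.exp_zero, WithZero.exp_le_exp] at h; omega
      · rw [he₀, hx1, one_mul, WithZero.exp_le_exp] at h; exact h
      · have h' := h.trans hwb; rw [he₀, WithZero.exp_le_exp] at h'; exact h'
  -- `|D₁| = exp c`
  have h2e1 : 2 * e₁ = (c : ℤ) := by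
    have hl : (c : ℤ) - 1 ≤ 2 * e₁ := by
      rw [he₁, hϖ, hzv, ← WithZero.exp_add, ← WithZero.exp_add, WithZero.exp_le_exp] at hA1z; omega
    have hu : 2 * e₁ ≤ (c : ℤ) := by
      rcases hA1eq with h | h
      · rw [he₁, WithZero.exp_le_exp] at h; omega
      · rw [he₁, hzv, ← WithZero.exp_add, WithZero.exp_le_exp] at h; omega
    omega
  have key := columnOne_exponent_le hvσ hϖ hD0 b c hx1 hM he₀ he₁ (by omega)
  rw [max_eq_right (by omega : 2 * e₀ ≤ 2 * e₁)] at key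
  rcases hb with rfl | rfl <;> push_cast at h2e0 key hbc <;> omega

/-- **X10b and X11b ARE NOT TYPE-2 POLARISABLE** (`m = b`, `c` even, `|y| = 1`, `|xz − yϖ^b| = |ϖ^(c−b+k)|` with (`k = 1`, `2 ≤ b`, `2b ≤ c`) or (`k = 2`, `3 ≤ b`, `2b − 2 ≤ c`); the second
halves of disjuncts 20–21 of ★ `typeTwo_sieve`): `|D₀| = exp(2b − 2)`, `|D₁| = |D₂| = exp c`; for `c > 2b − 2` the column-1 test fails, and at `c = 2b − 2` it gives
`|D₀ + N(x)D₁| ≤ exp(c−1) < exp c = |N(y)D₂|`, so `|G₀₀| = exp c > 1`. [cite: Jacobowitz1962, §7–§8] [cite: Kottwitz1986BaseChangeUnits, §1 pp. 240–241] [cite: Serre1980Trees, II §1.1] -/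
theorem not_typeTwoPolarisable_X10b_X11b (hvσ : ∀ a, Valued.v (σ a) = Valued.v a)
    (hfix : ∀ t : K, σ t = t → t ≠ 0 → ∃ n : ℤ, Valued.v t = WithZero.exp (2 * n)) (hϖ : Valued.v ϖ = WithZero.exp (-1 : ℤ))
    (hx : Valued.v x ≤ 1) (hy : Valued.v y ≤ 1) (hz : Valued.v z ≤ 1)
    (hn : IsNormalisedLattice (latt (Matrix.of ![![1, 0, 0], ![x, ϖ ^ b, 0], ![y, z, ϖ ^ c]])))
    (hce : c % 2 = 0) (hzb : Valued.v z = Valued.v (ϖ ^ b)) (hy1 : Valued.v y = 1) {k : ℕ} (hk : k = 1 ∨ k = 2) (hbk : k + 1 ≤ b) (hcb : 2 * b + 2 ≤ c + 2 * k)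
    (hw : Valued.v (x * z - y * ϖ ^ b) = Valued.v (ϖ ^ (c - b + k))) :
    ¬ ∃ D : Fin 3 → K, (∀ i, σ (D i) = D i ∧ D i ≠ 0) ∧ IsVertexLattice σ ϖ (Matrix.diagonal D) 2 (latt (Matrix.of ![![1, 0, 0], ![x, ϖ ^ b, 0], ![y, z, ϖ ^ c]])) := by
  rintro ⟨D, hDfix, hM⟩
  have hD0 : ∀ i, D i ≠ 0 := fun i => (hDfix i).2
  have hϖ0 : ϖ ≠ 0 := (Valuation.ne_zero_iff Valued.v).1 (by rw [hϖ]; exact WithZero.exp_ne_zero)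
  have hq : ∀ n : ℕ, Valued.v (ϖ ^ n) = WithZero.exp (-(n : ℤ)) := fun n => by
    rw [map_pow, hϖ, ← WithZero.exp_nsmul]; congr 1; simp
  have hq1 : ∀ n : ℕ, Valued.v (ϖ ^ n) ≤ 1 := fun n => by rw [hq, ← WithZero.exp_zero, WithZero.exp_le_exp]; omega
  have hN := (normalised_latt_hnf_iff hx hy hz (hq1 b) (hq1 c)).1 hn
  have hx1 : Valued.v x = 1 := hN.1.resolve_left fun h => by rw [hq, ← WithZero.exp_zero, WithZero.exp_inj] at h; omega
  obtain ⟨e₀, he₀⟩ := hfix (D 0) (hDfix 0).1 (hD0 0)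
  obtain ⟨e₁, he₁⟩ := hfix (D 1) (hDfix 1).1 (hD0 1)
  obtain ⟨e₂, he₂⟩ := hfix (D 2) (hDfix 2).1 (hD0 2)
  obtain ⟨⟨hA2l, hA2u⟩, ⟨-, hA1z, hA1eq⟩, ⟨-, -, hA0w, hA0eq⟩⟩ := dualFrame_sandwich hvσ hϖ hD0 b c hn hM
  obtain ⟨-, -, hG00, -⟩ := gram_values_of_type hvσ hϖ0 D b c x y z hM
  have hzv : Valued.v z = WithZero.exp (-(b : ℤ)) := by rw [hzb, hq]
  have hwv : Valued.v (x * z - y * ϖ ^ b) = WithZero.exp (-((c - b + k : ℕ) : ℤ)) := by rw [hw, hq]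
  have hcast : ((c - b + k : ℕ) : ℤ) = c - b + k := by push_cast; omega
  rw [hcast] at hwv
  -- `|D₀| = exp(2b − 2)`: `a₀ = b + c − w = 2b − k`
  have h2e0 : 2 * e₀ = 2 * (b : ℤ) - 2 := by
    have hl : 2 * (b : ℤ) - k - 1 ≤ 2 * e₀ := by
      rw [he₀, hϖ, hwv, ← WithZero.exp_add, ← WithZero.exp_add, WithZero.exp_le_exp] at hA0w; omega
    have hu : 2 * e₀ ≤ 2 * (b : ℤ) - k := by
      rcases hA0eq with h | h | h
      · rw [he₀, ← WithZero.exp_zero, WithZero.exp_le_exp] at h; omega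
      · rw [he₀, hx1, one_mul, WithZero.exp_le_exp] at h; omega
      · rw [he₀, hwv, ← WithZero.exp_add, WithZero.exp_le_exp] at h; omega
    rcases hk with rfl | rfl <;> push_cast at hl hu ⊢ <;> omega
  -- `|D₁| = exp c`, `|D₂| = exp c`
  have h2e1 : 2 * e₁ = (c : ℤ) := by
    have hl : (c : ℤ) - 1 ≤ 2 * e₁ := by
      rw [he₁, hϖ, hzv, ← WithZero.exp_add, ← WithZero.exp_add, WithZero.exp_le_exp] at hA1z; omega
    have hu : 2 * e₁ ≤ (c : ℤ) := by
      rcases hA1eq with h | h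
      · rw [he₁, WithZero.exp_le_exp] at h; omega
      · rw [he₁, hzv, ← WithZero.exp_add, WithZero.exp_le_exp] at h; omega
    omega
  have h2e2 : 2 * e₂ = (c : ℤ) := by
    have hl : (c : ℤ) - 1 ≤ 2 * e₂ := by rw [he₂, hϖ, ← WithZero.exp_add, WithZero.exp_le_exp] at hA2l; omega
    have hu : 2 * e₂ ≤ (c : ℤ) := by rw [he₂, WithZero.exp_le_exp] at hA2u; exact hA2u
    omega
  rcases lt_or_ge (2 * (b : ℤ) - 2) c with hlt | hge
  · -- generic: column-1 test fails
    have key := columnOne_exponent_le hvσ hϖ hD0 b c hx1 hM he₀ he₁ (by omega)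
    rw [max_eq_right (by omega : 2 * e₀ ≤ 2 * e₁)] at key
    omega
  · -- corner `c = 2b − 2`: `|E| ≤ exp(c−1) < exp c = |N(y)D₂|`, so `G₀₀` is not integral
    have hc : (c : ℤ) = 2 * b - 2 := by omega
    have hE := v_gramCore_le hvσ hϖ hD0 b c x y z hM
    rw [he₀, he₁, h2e0, h2e1, ← WithZero.exp_neg, ← WithZero.exp_neg, ← WithZero.exp_add] at hE
    have hE' : Valued.v (D 0 + x * σ x * D 1) ≤ WithZero.exp ((c : ℤ) - 1) := by
      have hne : WithZero.exp (-(2 * (b : ℤ) - 2) + -(c : ℤ)) ≠ 0 := WithZero.exp_ne_zero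
      calc Valued.v (D 0 + x * σ x * D 1)
          = Valued.v (D 0 + x * σ x * D 1) * WithZero.exp (-(2 * (b : ℤ) - 2) + -(c : ℤ)) * (WithZero.exp (-(2 * (b : ℤ) - 2) + -(c : ℤ)))⁻¹ := by
            rw [mul_inv_cancel_right₀ hne]
        _ ≤ WithZero.exp (1 - 2 * (b : ℤ)) * (WithZero.exp (-(2 * (b : ℤ) - 2) + -(c : ℤ)))⁻¹ := mul_le_mul' hE le_rfl
        _ = WithZero.exp ((c : ℤ) - 1) := by rw [← WithZero.exp_neg, ← WithZero.exp_add, WithZero.exp_inj]; omega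
    have hvNy : Valued.v (σ y * D 2 * y) = WithZero.exp (c : ℤ) := by rw [map_mul, map_mul, hvσ, hy1, he₂, h2e2, one_mul, mul_one]
    have hlt : Valued.v (D 0 + σ x * D 1 * x) < Valued.v (σ y * D 2 * y) := by
      rw [show D 0 + σ x * D 1 * x = D 0 + x * σ x * D 1 by ring, hvNy]
      exact lt_of_le_of_lt hE' (by rw [WithZero.exp_lt_exp]; omega)
    have hsum : D 0 + σ x * D 1 * x + σ y * D 2 * y = σ y * D 2 * y + (D 0 + σ x * D 1 * x) := by ring
    have h := hG00
    rw [hsum, Valuation.map_add_eq_of_lt_left _ hlt, hvNy, ← WithZero.exp_zero, WithZero.exp_le_exp] at h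
    omega

end Kills

end Summit.HodgeConjecture.HodgeConjecture.Cruxes.H413.F0P3cDyRamDiagonalTypeTwoExclColumnOne

end
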